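import Literature.NumberTheory.Automorphic.ResGLnCuspidalCohomologyApexBasic
import Literature.NumberTheory.Automorphic.ArchParameterSplitCentre
import HarnessLib

/-!
# Clozel's cocycle (apex fact (a′)): the scalars of the centre read off the infinity type —
# `Z = 1` kills `W ⊗ E_λ` for a cohomological `π`

Topic `NumberTheory/Automorphic`; namespace `Literature.NumberTheory.Automorphic.ConeDictionary` (the
vocabulary of `ResGLnConeDictionary` / `ResGLnCuspidalCohomologyApex*`: the carrier
`Carrier π λ = W ⊗ E_λ(ℂ)` of the complex `gkComplexLS π S λ`, the centre direction `Z = 1 = ⟨1, trivial⟩`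
of `𝔤 = 𝔤𝔩_n(K_∞)`, the scalar `coeffCentralWeight n K λ` of `Z` on `E_λ(ℂ)`).  Theorems only; no
definition, no named fact, no `sorry` (D-0026: nothing is vendored).

Input (ii) of the Kuga reduction `ResGLnCuspidalCohomologyApexKuga.
Clozel1990_exists_basic_levelFixed_cocycle_of_nonzero_basic_cochain` of the apex fact
`ConeDictionary.Clozel1990_exists_basic_levelFixed_cocycle`: for an automorphic representation
`π = W / ⊥` of `GL_n(𝔸_K)` whose infinity type has the `a`-multisets `{λ^∨_{τ,i} + ρ_i}` of the
cohomological type of `λ^∨` (`cohomologicalInfinityType n K λ_τ^∨`), the split centre `Z = 1` acts on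
`W` by `μ = ∑_τ ∑_i (λ^∨_{τ,i} + ρ_i) = -∑_{τ,i} λ_{τ,i}` (`ArchParameterSplitCentre`: `γ(1) = ∑ x_{τ,i}`,
[cite: Knapp2002, Thm. 5.44]) and on `E_λ(ℂ)` by `|λ| = ∑_{τ,i} λ_{τ,i}` (for dominant `λ`), so it KILLS
the carrier `W ⊗ E_λ` — the condition under which the `(𝔤, K_∞)`-cohomology lives on basic cochains
[cite: BorelWallach2000, I §1.3] and the central character of `π_∞ ⊗ E_λ` is trivial on `A_G`
[cite: Clozel1990, Lemme 3.15 (ii) (p. 121)]: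

* `sum_map_a_cohomologicalInfinityType` — `∑ (a-multiset of the cohomological type of wt) = ∑_i wt_i`
  (`∑ ρ_i = 0`); `sum_intCast_dual` — `∑_i wt^∨_i = -∑_i wt_i`;
* `coeffCentralWeight_eq_sum` — for dominant `λ`, `coeffCentralWeight n K λ = ∑_{τ,i} λ_{τ,i}`
  (`d_τ + n λ_{τ,n-1} = ∑_i λ_{τ,i}`);
* `centralScalar_eq_neg_sum` — the scalar `μ` of `Z` on `W ≠ 0` is `-∑_{τ,i} λ_{τ,i}`;
* **`lie_one_carrier_eq_zero`** — `⁅Z, t⁆ = 0` for every `t ∈ W ⊗ E_λ(ℂ)`.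

## References

* L. Clozel, *Motifs et formes automorphes: applications du principe de fonctorialité*, in:
  Automorphic forms, Shimura varieties, and L-functions I (Ann Arbor 1988), Perspect. Math. 10,
  Academic Press 1990: §3.3 (p. 106), Lemme 3.14 (p. 114), Lemme 3.15 (p. 121). [Clozel1990]
* A. Borel, N. Wallach, *Continuous cohomology, discrete subgroups, and representations of reductive
  groups*, 2nd ed., AMS 2000: I §1.3 (held). [BorelWallach2000]
* A. W. Knapp, *Lie Groups Beyond an Introduction*, 2nd ed. (2002), Thm. 5.44. [Knapp2002]
-/

noncomputable section

open scoped Classical TensorProduct Matrix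
open NumberField IsDedekindDomain NumberField.InfinitePlace NumberField.mixedEmbedding

namespace Literature.NumberTheory.Automorphic

namespace ConeDictionary

open ResGLnCohomology BigHeckeGLn RealMatrixGroup Literature.Algebra.Lie.ChevalleyEilenberg
  Literature.NumberTheory.DiophantineGeometry Literature.Barriers.Langlands

variable {n : ℕ} {K : Type} [Field K] [NumberField K] {hcpt : isCompact_glFiniteIntegralLevel n K}

/-! ### Sums of the cohomological `a`-multiset, of the dual weight, and of `coeffCentralWeight` -/

section Sums

omit [NumberField K] in
variable (n K) in
/-- **The `a`-multiset of the cohomological type of `wt` sums to `∑_i wt_i`** (`a_i = wt_i + ρ_i` and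
`∑_i ρ_i = 0`). [cite: BorelWallach2000, III 1.5] -/
theorem sum_map_a_cohomologicalInfinityType (wt : Fin n → ℤ) (τ : K →+* ℂ) :
    (((cohomologicalInfinityType n K wt) τ).map ArchWeight.a).sum = ∑ i : Fin n, (wt i : ℂ) := by
  change ((Finset.univ.val.map (cohomologicalArchWeight n wt)).map ArchWeight.a).sum = _
  rw [Multiset.map_map, ← Finset.sum_eq_multiset_sum]
  simp only [Function.comp_apply, cohomologicalArchWeight_a, Finset.sum_add_distrib, sum_rhoGL, add_zero]

/-- **`∑_i wt^∨_i = -∑_i wt_i`** (`wt^∨_i = -wt_{n-1-i}`, reindex by `Fin.rev`). [folklore] -/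
theorem sum_intCast_dual (wt : Fin n → ℤ) :
    ∑ i : Fin n, (Weight.dual wt i : ℂ) = -∑ i : Fin n, (wt i : ℂ) := by
  simp only [Weight.dual, Int.cast_neg, Finset.sum_neg_distrib, neg_inj]
  exact Fintype.sum_equiv Fin.revPerm _ _ fun i => rfl

variable (n K) in
/-- **For dominant `λ`, `coeffCentralWeight n K λ = ∑_{τ,i} λ_{τ,i}`**: `d_τ = ∑_i (λ_{τ,i} - λ_{τ,n-1})`
with non-negative summands, so `d_τ + n λ_{τ,n-1} = ∑_i λ_{τ,i}`. [cite: BorelWallach2000, 0 §2.3] -/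
theorem coeffCentralWeight_eq_sum {lam : (K →+* ℂ) → Fin n → ℤ} (hdom : ∀ τ, Weight.IsDominant (lam τ)) :
    coeffCentralWeight n K lam = ∑ τ : K →+* ℂ, ∑ i : Fin n, (lam τ i : ℂ) := by
  refine Finset.sum_congr rfl fun τ _ => ?_
  -- `∑_i (λ_i - λ_{n-1}) + n λ_{n-1} = ∑_i λ_i`, the differences being non-negative by dominance
  have hle : ∀ i : Fin n, GLnCohomology.lowestEntry (lam τ) ≤ lam τ i := by
    intro i
    cases n with
    | zero => exact i.elim0
    | succ m =>
      rw [GLnCohomology.lowestEntry_succ]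
      exact hdom τ (Fin.le_last i)
  have hshift : ∀ i : Fin n, ((GLnCohomology.polyShift (lam τ) i : ℕ) : ℤ) = lam τ i - GLnCohomology.lowestEntry (lam τ) :=
    fun i => Int.toNat_of_nonneg (sub_nonneg.2 (hle i))
  have hdeg : ((GLnCohomology.coeffDegree (lam τ) : ℕ) : ℤ) =
      ∑ i : Fin n, lam τ i - n * GLnCohomology.lowestEntry (lam τ) := by
    rw [GLnCohomology.coeffDegree, Nat.cast_sum]
    simp only [hshift, Finset.sum_sub_distrib, Finset.sum_const, Finset.card_univ, Fintype.card_fin,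
      nsmul_eq_mul]
  have h : ((GLnCohomology.coeffDegree (lam τ) : ℕ) : ℂ) =
      ∑ i : Fin n, (lam τ i : ℂ) - n * (GLnCohomology.lowestEntry (lam τ) : ℂ) := by
    have h' := congrArg (fun z : ℤ => (z : ℂ)) hdeg
    simp only [Int.cast_natCast, Int.cast_sub, Int.cast_sum, Int.cast_mul] at h'
    exact h'
  rw [h]
  ring

end Sums

/-! ### The scalar of `Z` on `W` from the infinity type, and `Z` killing `W ⊗ E_λ` -/

section Centre

variable (π : AutomorphicRepData (AutomorphyDatum.gl n K hcpt)) (lam : (K →+* ℂ) → Fin n → ℤ)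

/-- **The scalar of `Z` on `W` is `-∑_{τ,i} λ_{τ,i}`**: if `π = W / ⊥` has an infinity type with the
`a`-multisets of the cohomological type of `λ^∨`, `Z = 1` acts on `W` by `∑_τ ∑ (a-multiset)`
(`AutomorphicRepData.HasInfinityType.lieDeriv_one_sub_smul_mem`), and a scalar `μ` by which it acts on
some non-zero `φ ∈ W` is that sum, `= ∑_{τ,i} λ^∨_{τ,i} = -∑_{τ,i} λ_{τ,i}`.
[cite: Knapp2002, Thm. 5.44] [cite: Clozel1990, §3.3 (p. 106) and Lemme 3.14 (p. 114)] -/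
theorem centralScalar_eq_neg_sum (hW' : π.W' = ⊥) {μ : ℂ}
    (hμ : ∀ c ∈ π.W, lieDeriv (AutomorphyDatum.gl n K hcpt).ofArch
      (⟨1, trivial⟩ : (AutomorphyDatum.gl n K hcpt).arch.lie) c = μ • c)
    {T : InfinityType K n} (hT : π.HasInfinityType T)
    (hTa : ∀ τ : K →+* ℂ, (T τ).map ArchWeight.a =
      (cohomologicalInfinityType n K (Weight.dual (lam τ)) τ).map ArchWeight.a)
    {φ : (AdelicGroupData.gl n K).Adelic → ℂ} (hφ : φ ∈ π.W) (hφ0 : φ ≠ 0) :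
    μ = -∑ τ : K →+* ℂ, ∑ i : Fin n, (lam τ i : ℂ) := by
  have h1 := hT.lieDeriv_one_sub_smul_mem hφ
  rw [hW', Submodule.mem_bot, hμ φ hφ, ← sub_smul, smul_eq_zero] at h1
  have h2 : μ = ∑ σ : K →+* ℂ, ((T σ).map ArchWeight.a).sum := sub_eq_zero.1 (h1.resolve_right hφ0)
  rw [h2, ← Finset.sum_neg_distrib]
  refine Finset.sum_congr rfl fun σ _ => ?_
  rw [hTa σ, sum_map_a_cohomologicalInfinityType, sum_intCast_dual]

/-- **`Z = 1` kills the carrier `W ⊗ E_λ(ℂ)`** of `gkComplexLS π S λ` when `λ` is dominant, `W ≠ 0`,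
`Z` acts on `W` by a scalar and `π = W / ⊥` has the cohomological infinity type of `λ^∨`: the scalar of
`Z` on `W ⊗ E_λ` is `μ + |λ| = -∑ λ_{τ,i} + ∑ λ_{τ,i} = 0` (`lie_centerOne_carrier`).  This is hypothesis
(ii) of `Clozel1990_exists_basic_levelFixed_cocycle_of_nonzero_basic_cochain`.
[cite: BorelWallach2000, I §1.3] [cite: Clozel1990, Lemme 3.15 (ii) (p. 121)] -/
theorem lie_one_carrier_eq_zero (hdom : ∀ τ, Weight.IsDominant (lam τ)) (hW' : π.W' = ⊥) {μ : ℂ}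
    (hμ : ∀ c ∈ π.W, lieDeriv (AutomorphyDatum.gl n K hcpt).ofArch
      (⟨1, trivial⟩ : (AutomorphyDatum.gl n K hcpt).arch.lie) c = μ • c)
    {T : InfinityType K n} (hT : π.HasInfinityType T)
    (hTa : ∀ τ : K →+* ℂ, (T τ).map ArchWeight.a =
      (cohomologicalInfinityType n K (Weight.dual (lam τ)) τ).map ArchWeight.a)
    {φ : (AdelicGroupData.gl n K).Adelic → ℂ} (hφ : φ ∈ π.W) (hφ0 : φ ≠ 0) (t : Carrier π lam) :
    ⁅(⟨1, trivial⟩ : (AutomorphyDatum.gl n K hcpt).arch.lie), t⁆ = 0 := by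
  have h := lie_centerOne_carrier (π := π) (lam := lam) hμ t
  rw [centralScalar_eq_neg_sum π lam hW' hμ hT hTa hφ hφ0, coeffCentralWeight_eq_sum n K hdom,
    neg_add_cancel, zero_smul] at h
  exact h

end Centre

end ConeDictionary

end Literature.NumberTheory.Automorphic

end
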